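import Literature.NumberTheory.EllipticCurves.NonsplitPoints
import HarnessLib

/-!
# Route `AdditiveBranchIMC`, cruxes `GordTwoRankZeroOffCaseOne` (stmt-BirchSwinnertonDyer-19357) ∕ `MultLower` (19359),
# lines `three_field_road` ∕ `tame_roads_mult`, stub `stub_nonsplitFrobeniusSign[M]` (L2, skeleton v13):
# THE COORDINATE CORE OF THE KODAIRA–NÉRON–TATE SIGN — a bad point plus its conjugate under a
# tangent-swapping automorphism has nonsingular reduction

Cell `bsd-addord` (run/shared/lean/pub/bsd-addord/), seat `cruxlead-19357-g2` (lead prover), HELPER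
(`--supports stmt-BirchSwinnertonDyer-19357 --as helper`). Skeleton v13 (`Lines/three_field_road.lean` 3b0d486a3202,
`Lines/tame_roads_mult.lean` 762befcaecca) leaves ONE arithmetic stub, `stub_nonsplitFrobeniusSign[M]`: at a NON-SPLIT
multiplicative place `v`, every arithmetic Frobenius `F` satisfies `F • Q + Q ∈ E⁰(K̄_v)` for every inertia-fixed
`Q ∈ X(K̄_v)` ("Frobenius acts as `−1` on the component group `Φ_v(k̄_v)`", Silverman ATAEC Cor. IV.9.2 (d); the input
of McCallum's non-split mechanism `…GenusKolyvaginLocalNonsplitMechanism`, p678098). This file proves its COORDINATE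
CORE over an abstract discrete valuation ring, with NO component group and NO Tate curve: the inertia-fixed points are
the points over the valuation ring `R = 𝒪_v^{un}` of `K_v^{un}`, the Frobenius is an automorphism `σ` of `R`, the
minimal model in the tree's non-split normal form (`NonsplitNormalForm`: `a₃ = a₄ = 0`, `a₆ ∈ 𝔪`, tangent form
`T² + a₁T − a₂` irreducible over `k_v`) acquires over `R` the two tangent slopes `ρ, ρ′` (Hensel), which `σ` SWAPS,
and no `σ`-fixed element of `R` reduces to `ρ̄` (the fixed field of the residual Frobenius is `k_v ∌ ρ̄`).

* §1 `valuation_algebraMap_ringEquiv` — an automorphism of a DVR preserves the valuation.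
* §2 `isUnit_of_swap_data` — the valuation computation: with branch coordinates `a = y − ρx`, `b = y − ρ′x`
  (`a − b = (ρ′−ρ)x`, `ab = x³ + a₆`) and `m (x − σx) = a − σb`, `(m − ρ′ + ρ)(x − σx) = b − σa`, the element `m`
  (= `λ − ρ` for the chord slope `λ`) is a unit: were `m ∈ 𝔪`, comparing `|a|`, `|b|` (three cases; in the case
  `|a| = |b|` through the two expressions `ab − σaσb = (x − σx)(x² + xσx + σx²) = a(b − σa) + σa(a − σb)`) contradicts
  `|a − σb| < |x − σx| ≤ |x| < 1`.
* §3 **`hasNonsingularReduction_add_conj`** — for a bad point `P = (x, y)` (`x ∈ 𝔪`) of `J(K)` and its conjugate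
  `P^σ = (σx, σy)`: `P + P^σ ∈ J₀(K)` (nonsingular reduction). Chord case by §2 twice (`λ − ρ`, `λ − ρ′` units, so
  `x(P + P^σ) = (λ−ρ)(λ−ρ′) − x − σx` is a unit, tree `hasNonsingularReduction_some_of_isUnit`; a non-integral slope
  gives reduction `𝒪`, tree `one_lt_v_addX_of_one_lt_v_slope`); tangent case (`P^σ = P`): the slope is `σ`-fixed.
  The Frobenius-pair analogue of the tree's `LocalIndex.hasNonsingularReduction_add_of_anisotropic` (ATAEC IV.9.4 Step 2,
  the `K_v`-RATIONAL index `≤ 2`), which it replaces for points over unramified layers of EVEN residue degree.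

What remains for L2 (transport, no new arithmetic): instantiate `R = unrIntegers`, `σ = Frob|_{K_v^{un}}`, the normal
form and its Hensel roots, and carry `J₀` to `X11b.E0Receptacle` along the chain of x11b3's
`ordMinimalDiscriminant_nsmul_mem_E0Receptacle` ∕ `KodairaNeronUnramifiedMultiplicativeBoundProofs`.

THEOREMS ONLY; no `sorry`; nothing about BSD is proved here; the cruxes stay OPEN.

References: [cite: SilvermanATAEC1994, Cor. IV.9.2 (d), Thm. IV.9.4 Step 2] [cite: SilvermanAEC2009, VII.2 Prop. 2.1,
Thm. VII.6.1, App. C §15] [cite: McCallumLMS1991, Lemma 4.3 (proof)].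

presearch: «Frobenius acts by −1 on the component group at a non-split multiplicative place; sum of a point and its
Frobenius conjugate reduces to the identity component» → [corpus: SilvermanATAEC1994 IV.9 (Tate's algorithm, Step 2;
Cor. 9.2(d))] statement level; tree `NonsplitPoints` / `KodairaNeronSplitCyclicProofs` (rational anisotropy, cyclic
quotient; no Galois action); galaxy "non-split multiplicative|component group" → textbook pages. The coordinate
argument here (branch coordinates + conjugation) is ours; no prior formal treatment found.
-/

noncomputable section

open scoped Classical

open IsLocalRing

set_option linter.dupNamespace false

namespace Summit.BirchSwinnertonDyer.BirchSwinnertonDyer.Theorems.GenusKolyvagin.NonsplitSign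

open Literature.NumberTheory.EllipticCurves Literature.NumberTheory.EllipticCurves.LocalIndex

variable {R : Type*} [CommRing R] [IsDomain R] [IsDiscreteValuationRing R]
  {K : Type*} [Field K] [Algebra R K] [IsFractionRing R K]

variable (K) in
/-- A ring automorphism of a discrete valuation ring preserves the valuation. [folklore] -/
theorem valuation_algebraMap_ringEquiv (σ : R ≃+* R) (r : R) :
    ValuationRing.valuation R K (algebraMap R K (σ r)) =
      ValuationRing.valuation R K (algebraMap R K r) := by
  have hv := integers_valuationRing_valuation R K
  by_cases hr : r = 0
  · simp [hr]
  obtain ⟨ϖ, hϖ⟩ := IsDiscreteValuationRing.exists_irreducible R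
  obtain ⟨n, w, hrw⟩ := IsDiscreteValuationRing.eq_unit_mul_pow_irreducible hr hϖ
  have hσϖ : Irreducible (σ ϖ) := (MulEquiv.irreducible_iff σ).mpr hϖ
  obtain ⟨c, hc⟩ := IsDiscreteValuationRing.associated_of_irreducible R hσϖ hϖ
  have hu : ∀ u : R, IsUnit u → ValuationRing.valuation R K (algebraMap R K u) = 1 := fun u hu ↦
    hv.isUnit_iff_valuation_eq_one.mp hu
  have hϖv : ValuationRing.valuation R K (algebraMap R K (σ ϖ)) =
      ValuationRing.valuation R K (algebraMap R K ϖ) := by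
    conv_rhs => rw [← hc]
    rw [map_mul, map_mul, hu _ c.isUnit, mul_one]
  rw [hrw, map_mul σ, map_pow σ]
  simp only [map_mul, map_pow]
  rw [hu _ (w.isUnit.map σ), hu _ w.isUnit, hϖv]

/-- In a linearly ordered commutative group with zero, `a * c ≤ b * c` with `c ≠ 0` gives `a ≤ b`. [folklore] -/
private theorem le_of_mul_le_mul_right_ne_zero {Γ : Type*} [LinearOrderedCommGroupWithZero Γ]
    {a b c : Γ} (h : a * c ≤ b * c) (hc : c ≠ 0) : a ≤ b := by
  have := mul_le_mul' h (le_refl c⁻¹)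
  rwa [mul_inv_cancel_right₀ hc, mul_inv_cancel_right₀ hc] at this

/-- In a linearly ordered commutative group with zero, `a < b` and `c ≠ 0` give `a * c < b * c`. [folklore] -/
private theorem mul_lt_mul_right_ne_zero {Γ : Type*} [LinearOrderedCommGroupWithZero Γ]
    {a b c : Γ} (h : a < b) (hc : c ≠ 0) : a * c < b * c := by
  by_contra hle
  exact (not_le.mpr h) (le_of_mul_le_mul_right_ne_zero (not_lt.mp hle) hc)

/-- **The valuation core of the sign lemma.** In a discrete valuation ring `R` with an automorphism `σ`: let
`x ∈ 𝔪` with `σ x ≠ x`, `a`, `b`, `c` with `σ c = c`, a unit `δ` with `a − b = δ x` and `a b = x³ + c`, and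
`m` with `m (x − σx) = a − σ b`, `(m − δ)(x − σx) = b − σ a`. Then `m` is a unit. (Printed: for a bad point
`(x, y)` of `y² + a₁xy − a₂x² = x³ + a₆` with branch coordinates `a = y − ρx`, `b = y − ρ′x`, `σρ = ρ′`, the
slope `λ` of the chord to the conjugate point has `λ − ρ = m` a unit.) [folklore] -/
theorem isUnit_of_swap_data (σ : R ≃+* R) {x a b c δ m : R} (hx : x ∈ maximalIdeal R)
    (hxσ : x ≠ σ x) (hδ : IsUnit δ) (hab : a - b = δ * x)
    (hprod : a * b = x ^ 3 + c) (hc : σ c = c) (hm : m * (x - σ x) = a - σ b)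
    (hm' : (m - δ) * (x - σ x) = b - σ a) : IsUnit m := by
  let F := FractionRing R
  have hv := integers_valuationRing_valuation R F
  set v := ValuationRing.valuation R F with hvdef
  set ι := algebraMap R F with hι
  have hinj : Function.Injective ι := IsFractionRing.injective R F
  have hσv : ∀ r : R, v (ι (σ r)) = v (ι r) := valuation_algebraMap_ringEquiv F σ
  have hunit : ∀ u : R, IsUnit u → v (ι u) = 1 := fun u hu ↦ hv.isUnit_iff_valuation_eq_one.mp hu
  have hlt1 : ∀ r : R, r ∈ maximalIdeal R → v (ι r) < 1 := fun r hr ↦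
    (v_algebraMap_lt_one_iff hv r).mpr ((residue_eq_zero_iff _).mpr hr)
  by_contra hmu
  have hmm : m ∈ maximalIdeal R := (IsLocalRing.mem_maximalIdeal _).mpr (mem_nonunits_iff.mpr hmu)
  -- `m − δ` is a unit
  have hmδ : IsUnit (m - δ) := by
    by_contra hn
    have h1 : m - δ ∈ maximalIdeal R := (IsLocalRing.mem_maximalIdeal _).mpr (mem_nonunits_iff.mpr hn)
    have h2 : δ ∈ maximalIdeal R := by
      have := Ideal.sub_mem _ hmm h1; rwa [sub_sub_cancel] at this
    exact (IsLocalRing.mem_maximalIdeal _ |>.mp h2) hδ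
  -- the basic valuations
  have hxσ0 : v (ι (x - σ x)) ≠ 0 := by
    rw [Valuation.ne_zero_iff, map_ne_zero_iff _ hinj]; exact sub_ne_zero.mpr hxσ
  have hxσle : v (ι (x - σ x)) ≤ v (ι x) := by
    rw [ι.map_sub]
    refine (v.map_sub _ _).trans (max_le le_rfl ?_)
    rw [hσv]
  have haσb : v (ι (a - σ b)) < v (ι (x - σ x)) := by
    rw [← hm, ι.map_mul, Valuation.map_mul]
    calc v (ι m) * v (ι (x - σ x)) < 1 * v (ι (x - σ x)) :=
          mul_lt_mul_right_ne_zero (hlt1 m hmm) hxσ0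
      _ = v (ι (x - σ x)) := one_mul _
  have hbσa : v (ι (b - σ a)) = v (ι (x - σ x)) := by
    rw [← hm', ι.map_mul, Valuation.map_mul, hunit _ hmδ, one_mul]
  have habx : v (ι (a - b)) = v (ι x) := by
    rw [hab, ι.map_mul, Valuation.map_mul, hunit _ hδ, one_mul]
  rcases lt_trichotomy (v (ι a)) (v (ι b)) with hlt | heq | hgt
  · -- `|a| < |b| = |x|`, so `|a − σb| = |σ b| = |x| ≥ |x − σx|`
    have hb : v (ι b) = v (ι x) := by
      rw [← habx, ι.map_sub, v.map_sub_eq_of_lt_right hlt]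
    have h' : v (ι a) < v (ι (σ b)) := by rw [hσv]; exact hlt
    have h1 : v (ι (a - σ b)) = v (ι x) := by
      rw [ι.map_sub, v.map_sub_eq_of_lt_right h', hσv, hb]
    exact (lt_irrefl _) ((h1 ▸ haσb).trans_le hxσle)
  · -- `|a| = |b| = μ ≥ |x|`: compare the two expressions of `ab − σa σb`
    have hμx : v (ι x) ≤ v (ι a) := by
      rw [← habx, ι.map_sub]
      exact (v.map_sub _ _).trans (max_le le_rfl heq.ge)
    have ha0 : v (ι a) ≠ 0 := by
      intro h0
      have ha0' : a = 0 := hinj (by rw [map_zero]; exact (Valuation.zero_iff v).mp h0)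
      have hb0 : b = 0 := hinj (by rw [map_zero]; exact (Valuation.zero_iff v).mp (heq ▸ h0))
      have hx0 : x = 0 := by
        have : δ * x = 0 := by rw [← hab, ha0', hb0, sub_zero]
        exact (mul_eq_zero.mp this).resolve_left hδ.ne_zero
      exact hxσ (by rw [hx0, map_zero])
    have hx0' : v (ι x) ≠ 0 := by
      intro h0
      have hx0 : x = 0 := hinj (by rw [map_zero]; exact (Valuation.zero_iff v).mp h0)
      exact hxσ (by rw [hx0, map_zero])
    -- `ab − σa σb = (x − σx)(x² + xσx + σx²)`
    have hid1 : a * b - σ a * σ b = (x - σ x) * (x ^ 2 + x * σ x + σ x ^ 2) := by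
      have : σ a * σ b = σ x ^ 3 + c := by rw [← map_mul, hprod, map_add, map_pow, hc]
      rw [this, hprod]; ring
    -- `ab − σa σb = a (b − σa) + σa (a − σb)`
    have hid2 : a * b - σ a * σ b = a * (b - σ a) + σ a * (a - σ b) := by ring
    have hlt' : v (ι (σ a) * ι (a - σ b)) < v (ι a * ι (b - σ a)) := by
      rw [Valuation.map_mul, Valuation.map_mul, hbσa, hσv, mul_comm (v (ι a)) _, mul_comm (v (ι a)) _]
      exact mul_lt_mul_right_ne_zero haσb ha0
    have hbig : v (ι (a * b - σ a * σ b)) = v (ι a) * v (ι (x - σ x)) := by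
      rw [hid2, ι.map_add, ι.map_mul, ι.map_mul, v.map_add_eq_of_lt_left hlt', Valuation.map_mul, hbσa]
    have hsmall : v (ι (a * b - σ a * σ b)) ≤ v (ι (x - σ x)) * (v (ι x) * v (ι x)) := by
      rw [hid1, ι.map_mul, Valuation.map_mul]
      refine mul_le_mul' le_rfl ?_
      rw [ι.map_add, ι.map_add]
      refine (v.map_add _ _).trans (max_le ((v.map_add _ _).trans (max_le ?_ ?_)) ?_)
      · rw [ι.map_pow, Valuation.map_pow, pow_two]
      · rw [ι.map_mul, Valuation.map_mul, hσv]
      · rw [ι.map_pow, Valuation.map_pow, hσv, pow_two]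
    rw [hbig, mul_comm (v (ι (x - σ x))) _] at hsmall
    have h3 : v (ι a) ≤ v (ι x) * v (ι x) := le_of_mul_le_mul_right_ne_zero hsmall hxσ0
    have h5 : (1 : ValuationRing.ValueGroup R F) ≤ v (ι x) :=
      le_of_mul_le_mul_right_ne_zero (by rw [one_mul]; exact hμx.trans h3) hx0'
    exact (not_le.mpr (hlt1 x hx)) h5
  · -- `|b| < |a| = |x|`, so `|a − σb| = |a| = |x| ≥ |x − σx|`
    have ha' : v (ι a) = v (ι x) := by
      rw [← habx, ι.map_sub, v.map_sub_eq_of_lt_left hgt]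
    have h' : v (ι (σ b)) < v (ι a) := by rw [hσv]; exact hgt
    have h1 : v (ι (a - σ b)) = v (ι x) := by
      rw [ι.map_sub, v.map_sub_eq_of_lt_left h', ha']
    exact (lt_irrefl _) ((h1 ▸ haσb).trans_le hxσle)


/-- A unit minus an element of the maximal ideal is a unit. [folklore] -/
private theorem isUnit_sub_of_mem {u m : R} (hu : IsUnit u) (hm : m ∈ maximalIdeal R) : IsUnit (u - m) := by
  by_contra hn
  have h1 : u - m ∈ maximalIdeal R := (IsLocalRing.mem_maximalIdeal _).mpr (mem_nonunits_iff.mpr hn)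
  have h2 : u ∈ maximalIdeal R := by
    have := Ideal.add_mem _ h1 hm; rwa [sub_add_cancel] at this
  exact (mem_nonunits_iff.mp ((IsLocalRing.mem_maximalIdeal _).mp h2)) hu

/-- A ring automorphism maps the maximal ideal into itself. [folklore] -/
private theorem map_mem_maximalIdeal (σ : R ≃+* R) {r : R} (hr : r ∈ maximalIdeal R) :
    σ r ∈ maximalIdeal R := by
  refine (IsLocalRing.mem_maximalIdeal _).mpr (mem_nonunits_iff.mpr fun hu ↦ ?_)
  refine (mem_nonunits_iff.mp ((IsLocalRing.mem_maximalIdeal _).mp hr)) ?_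
  have := hu.map σ.symm
  rwa [RingEquiv.symm_apply_apply] at this

/-- **The sign lemma in coordinates: a bad point plus its conjugate under a tangent-swapping automorphism lies
in `E₀`.** `R` a discrete valuation ring with fraction field `K`, `J : y² + a₁xy = x³ + a₂x² + a₆` over `R`
(`a₃ = a₄ = 0`, `a₆ ∈ 𝔪`) whose tangent form at the node `(0, 0)` splits over `R` as `(T − ρ)(T − ρ′)` with
`ρ̄ ≠ ρ̄′` (`ρ + ρ′ = −a₁`, `ρρ′ = −a₂`, `ρ′ − ρ ∈ R×`); `σ` an automorphism of `R` fixing `a₁, a₂, a₆`,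
SWAPPING `ρ` and `ρ′`, and such that every `σ`-fixed element has residue `≠ ρ̄` (printed: `R = 𝒪_v^{un}`, `σ` the
Frobenius, `J` the non-split node over `𝒪_v`, whose tangent slopes are conjugate over `k_v`). Then for every bad
point `P = (x, y)` (`x ∈ 𝔪`) of `J(K)`, `P + P^σ` has nonsingular reduction. Proof: the chord/tangent slope
`λ` is either non-integral (the sum reduces to `𝒪`) or integral with `λ − ρ`, `λ − ρ′` units
(`isUnit_of_swap_data` on the branch coordinates `y − ρx`, `y − ρ′x`; in the tangent case `P^σ = P` the slope is
`σ`-fixed), so `x(P + P^σ) = (λ−ρ)(λ−ρ′) − x − σx` is a unit. This is the Frobenius-pair analogue of the tree's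
`LocalIndex.hasNonsingularReduction_add_of_anisotropic` (Silverman ATAEC IV.9.4 Step 2) and the coordinate heart
of "Frobenius acts as `−1` on the component group of a non-split node". [cite: SilvermanATAEC1994, IV.9.4 Step 2,
Cor. IV.9.2 (d)] [cite: McCallumLMS1991, Lemma 4.3 (proof)] -/
theorem hasNonsingularReduction_add_conj (J : WeierstrassCurve R) (h3 : J.a₃ = 0) (h4 : J.a₄ = 0)
    (h6 : J.a₆ ∈ maximalIdeal R) {ρ ρ' : R} (hs : ρ + ρ' = -J.a₁) (hp : ρ * ρ' = -J.a₂)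
    (hδ : IsUnit (ρ' - ρ)) (σ : R ≃+* R) (hσ1 : σ J.a₁ = J.a₁) (hσ2 : σ J.a₂ = J.a₂)
    (hσ6 : σ J.a₆ = J.a₆) (hσρ : σ ρ = ρ') (hσρ' : σ ρ' = ρ) (hfix : ∀ r : R, σ r = r → IsUnit (r - ρ))
    {x y : R} (hx : x ∈ maximalIdeal R)
    (h : (J.baseChange K).toAffine.Nonsingular (algebraMap R K x) (algebraMap R K y))
    (h' : (J.baseChange K).toAffine.Nonsingular (algebraMap R K (σ x)) (algebraMap R K (σ y))) :
    J.HasNonsingularReduction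
      (WeierstrassCurve.Affine.Point.some _ _ h + WeierstrassCurve.Affine.Point.some _ _ h') := by
  have hv := integers_valuationRing_valuation R K
  have hinj := IsFractionRing.injective R K
  have h3m : J.a₃ ∈ maximalIdeal R := by rw [h3]; exact zero_mem _
  have h4m : J.a₄ ∈ maximalIdeal R := by rw [h4]; exact zero_mem _
  by_cases hxy : algebraMap R K x = algebraMap R K (σ x) ∧
      algebraMap R K y = (J.baseChange K).toAffine.negY (algebraMap R K (σ x)) (algebraMap R K (σ y))
  · rw [WeierstrassCurve.Affine.Point.add_of_Y_eq hxy.1 hxy.2]; trivial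
  rw [WeierstrassCurve.Affine.Point.add_some hxy]
  set L := (J.baseChange K).toAffine.slope (algebraMap R K x) (algebraMap R K (σ x))
    (algebraMap R K y) (algebraMap R K (σ y)) with hL
  by_cases hLv : 1 < ValuationRing.valuation R K L
  · exact Or.inl ((not_mem_range_iff hv).mpr
      (one_lt_v_addX_of_one_lt_v_slope hv (hv.map_le_one x) (hv.map_le_one (σ x)) hLv))
  obtain ⟨ℓ, hℓ⟩ := hv.exists_of_le_one (not_lt.mp hLv)
  have hX : (J.baseChange K).toAffine.addX (algebraMap R K x) (algebraMap R K (σ x)) L =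
      algebraMap R K (ℓ ^ 2 + J.a₁ * ℓ - J.a₂ - x - σ x) := by
    rw [WeierstrassCurve.Affine.addX, ← hℓ]; simp [WeierstrassCurve.baseChange]
  refine hasNonsingularReduction_some_of_isUnit J h3m h4m h6 ?_ _ hX
  -- it suffices that `ℓ − ρ` and `ℓ − ρ′` are units
  suffices hu : IsUnit (ℓ - ρ) ∧ IsUnit (ℓ - ρ') by
    have hid : ℓ ^ 2 + J.a₁ * ℓ - J.a₂ - x - σ x = (ℓ - ρ) * (ℓ - ρ') - (x + σ x) := by
      linear_combination ℓ * hs - hp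
    rw [hid]
    exact isUnit_sub_of_mem (hu.1.mul hu.2) (Ideal.add_mem _ hx (map_mem_maximalIdeal σ hx))
  -- the curve equation in `R`: `(y − ρx)(y − ρ′x) = x³ + a₆`
  have heqR : J.toAffine.Equation x y :=
    (WeierstrassCurve.Affine.map_equation _ hinj x y).mp h.1
  have hprod : (y - ρ * x) * (y - ρ' * x) = x ^ 3 + J.a₆ := by
    rw [WeierstrassCurve.Affine.equation_iff] at heqR
    have e3 : J.toAffine.a₃ = 0 := h3
    have e4 : J.toAffine.a₄ = 0 := h4
    have e1 : J.toAffine.a₁ = J.a₁ := rfl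
    have e2 : J.toAffine.a₂ = J.a₂ := rfl
    have e6 : J.toAffine.a₆ = J.a₆ := rfl
    rw [e3, e4, e1, e2, e6] at heqR
    linear_combination heqR + (-(x * y)) * hs + x ^ 2 * hp
  by_cases hxx : x = σ x
  · -- tangent case: `σ` fixes `x`, hence `y`, hence the slope
    have hxK : algebraMap R K x = algebraMap R K (σ x) := by rw [← hxx]
    have hyy : y = σ y :=
      hinj (WeierstrassCurve.Affine.Y_eq_of_Y_ne h.1 h'.1 hxK (fun hh ↦ hxy ⟨hxK, hh⟩))
    have hσx : σ x = x := hxx.symm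
    have hσy : σ y = y := hyy.symm
    have hLD := slope_mul_eq h.1 h'.1 hxy
    have e1 : algebraMap R K y + algebraMap R K (σ y) +
        (J.baseChange K).toAffine.a₁ * algebraMap R K x + (J.baseChange K).toAffine.a₃ =
          algebraMap R K (y + σ y + J.a₁ * x + J.a₃) := by
      simp [WeierstrassCurve.baseChange]
    have e2 : algebraMap R K x ^ 2 + algebraMap R K x * algebraMap R K (σ x) +
        algebraMap R K (σ x) ^ 2 +
        (J.baseChange K).toAffine.a₂ * (algebraMap R K x + algebraMap R K (σ x)) +
        (J.baseChange K).toAffine.a₄ - (J.baseChange K).toAffine.a₁ * algebraMap R K (σ y) =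
          algebraMap R K (x ^ 2 + x * σ x + σ x ^ 2 + J.a₂ * (x + σ x) + J.a₄ - J.a₁ * σ y) := by
      simp [WeierstrassCurve.baseChange]
    rw [← hL, ← hℓ, e1, e2, ← map_mul] at hLD
    have hR : ℓ * (y + σ y + J.a₁ * x + J.a₃) =
        x ^ 2 + x * σ x + σ x ^ 2 + J.a₂ * (x + σ x) + J.a₄ - J.a₁ * σ y := hinj hLD
    have hD : y + σ y + J.a₁ * x + J.a₃ ≠ 0 := by
      intro h0
      apply hxy
      refine ⟨hxK, ?_⟩
      have hyeq : y = -σ y - J.a₁ * σ x - J.a₃ := by rw [hσx]; linear_combination h0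
      rw [WeierstrassCurve.Affine.negY]
      conv_lhs => rw [hyeq]
      simp [WeierstrassCurve.baseChange]
    have hσD : σ (y + σ y + J.a₁ * x + J.a₃) = y + σ y + J.a₁ * x + J.a₃ := by
      simp only [map_add, map_mul, hσx, hσy, hσ1, h3, map_zero]
    have hσN : σ (x ^ 2 + x * σ x + σ x ^ 2 + J.a₂ * (x + σ x) + J.a₄ - J.a₁ * σ y) =
        x ^ 2 + x * σ x + σ x ^ 2 + J.a₂ * (x + σ x) + J.a₄ - J.a₁ * σ y := by
      simp only [map_add, map_sub, map_mul, map_pow, hσx, hσy, hσ1, hσ2, h4, map_zero]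
    have hσℓ : σ ℓ = ℓ := by
      have h1 := congrArg σ hR
      rw [map_mul, hσD, hσN, ← hR] at h1
      exact mul_right_cancel₀ hD h1
    have hu1 : IsUnit (ℓ - ρ) := hfix ℓ hσℓ
    have hu2 : IsUnit (ℓ - ρ') := by
      by_contra hn
      have hm : ℓ - ρ' ∈ maximalIdeal R :=
        (IsLocalRing.mem_maximalIdeal _).mpr (mem_nonunits_iff.mpr hn)
      have hm' := map_mem_maximalIdeal σ hm
      rw [map_sub, hσℓ, hσρ'] at hm'
      exact (mem_nonunits_iff.mp ((IsLocalRing.mem_maximalIdeal _).mp hm')) hu1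
    exact ⟨hu1, hu2⟩
  · -- chord case: `ℓ (x − σx) = y − σy`, and the valuation core on the branch coordinates
    have hxK : algebraMap R K x ≠ algebraMap R K (σ x) := fun hh ↦ hxx (hinj hh)
    have hR : ℓ * (x - σ x) = y - σ y := by
      apply hinj
      rw [map_mul, map_sub, map_sub, hℓ, hL, WeierstrassCurve.Affine.slope_of_X_ne hxK,
        div_mul_cancel₀ _ (sub_ne_zero.mpr hxK)]
    refine ⟨?_, ?_⟩
    · refine isUnit_of_swap_data σ hx hxx (a := y - ρ * x) (b := y - ρ' * x) (c := J.a₆)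
        (δ := ρ' - ρ) (m := ℓ - ρ) hδ (by ring) hprod hσ6 ?_ ?_
      · rw [map_sub, map_mul, hσρ']; linear_combination hR
      · rw [map_sub, map_mul, hσρ]; linear_combination hR
    · have hδ' : IsUnit (ρ - ρ') := by rw [← neg_sub]; exact hδ.neg
      have hprod' : (y - ρ' * x) * (y - ρ * x) = x ^ 3 + J.a₆ := by rw [mul_comm]; exact hprod
      refine isUnit_of_swap_data σ hx hxx (a := y - ρ' * x) (b := y - ρ * x) (c := J.a₆)
        (δ := ρ - ρ') (m := ℓ - ρ') hδ' (by ring) hprod' hσ6 ?_ ?_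
      · rw [map_sub, map_mul, hσρ]; linear_combination hR
      · rw [map_sub, map_mul, hσρ']; linear_combination hR

end Summit.BirchSwinnertonDyer.BirchSwinnertonDyer.Theorems.GenusKolyvagin.NonsplitSign

end
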